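import Mathlib
/-! # Stub `stub_engineCollinear` — crux `TwoProducts` (stmt-ValiantsHypothesis-5906), line `corner-log-linearization`
   The collinear rung of the engine: if every factor `u_i`, `v_i` has constant term `1` and all its
   other monomials lie on one affine line `ν · q = c` (`ν ∈ ℤ²` arbitrary, `c ≠ 0`), then every
   exponent `e` of `D = ∏ u_i - ∏ v_i` satisfies `ν · e = r * c` with `1 ≤ r ≤ n` (the constant
   terms cancel, and `e` is a sum of letters of which `r ≥ 1` are nonzero).  On one level line
   `ν · q = r * c` (a genuine line: `ν ≠ 0` since `r * c ≠ 0`) the rotated form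
   `ρ q = ν₁ q₀ - ν₀ q₁` is an injective parameter and every linear form is affine in `ρ`, so a
   strict minimiser of a linear form over `supp D` never lies strictly `ρ`-between two other
   support points of its level: each level carries at most two south-west vertices, whence at
   most `2n` in total.  Adapted line by line from the sister file
   `NewtonUnitEquationsTwoProductsHomogeneous.lean` (positive grading, parameter `q₀`). [folklore] -/
set_option linter.dupNamespace false -- single-conjunct summit: `ValiantsHypothesis.ValiantsHypothesis`
namespace Summit.ValiantsHypothesis.ValiantsHypothesis.Theorems.TwoProducts.Collinear
open scoped BigOperators
open MvPolynomial

/-- Interpolation on a level line of an arbitrary integer normal `ν`: if `a`, `m`, `b` have the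
same `ν`-level and `ρ a < ρ m < ρ b` for the rotated form `ρ q = ν 1 * q 0 - ν 0 * q 1`, then no
linear form is strictly smaller at `m` than at both `a` and `b` (indeed
`(ρ b - ρ m) • (m - a) = (ρ m - ρ a) • (b - m)`, so `m` is a convex combination of `a`, `b`).
[folklore] -/
theorem not_strict_min_between (ν : Fin 2 → ℤ) (w : Fin 2 → ℤ) (a m b : Fin 2 →₀ ℕ)
    (hla : ν 0 * (a 0 : ℤ) + ν 1 * (a 1 : ℤ) = ν 0 * (m 0 : ℤ) + ν 1 * (m 1 : ℤ))
    (hlb : ν 0 * (b 0 : ℤ) + ν 1 * (b 1 : ℤ) = ν 0 * (m 0 : ℤ) + ν 1 * (m 1 : ℤ))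
    (ham : ν 1 * (a 0 : ℤ) - ν 0 * (a 1 : ℤ) < ν 1 * (m 0 : ℤ) - ν 0 * (m 1 : ℤ))
    (hmb : ν 1 * (m 0 : ℤ) - ν 0 * (m 1 : ℤ) < ν 1 * (b 0 : ℤ) - ν 0 * (b 1 : ℤ))
    (lta : w 0 * (m 0 : ℤ) + w 1 * (m 1 : ℤ) < w 0 * (a 0 : ℤ) + w 1 * (a 1 : ℤ))
    (ltb : w 0 * (m 0 : ℤ) + w 1 * (m 1 : ℤ) < w 0 * (b 0 : ℤ) + w 1 * (b 1 : ℤ)) : False := by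
  have hA : (0 : ℤ) < (ν 1 * (b 0 : ℤ) - ν 0 * (b 1 : ℤ)) - (ν 1 * (m 0 : ℤ) - ν 0 * (m 1 : ℤ)) :=
    sub_pos.mpr hmb
  have hB : (0 : ℤ) < (ν 1 * (m 0 : ℤ) - ν 0 * (m 1 : ℤ)) - (ν 1 * (a 0 : ℤ) - ν 0 * (a 1 : ℤ)) :=
    sub_pos.mpr ham
  have i1 := mul_lt_mul_of_pos_left lta hA
  have i2 := mul_lt_mul_of_pos_left ltb hB
  have key : ((ν 1 * (b 0 : ℤ) - ν 0 * (b 1 : ℤ)) - (ν 1 * (m 0 : ℤ) - ν 0 * (m 1 : ℤ))) *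
        (w 0 * (a 0 : ℤ) + w 1 * (a 1 : ℤ)) +
      ((ν 1 * (m 0 : ℤ) - ν 0 * (m 1 : ℤ)) - (ν 1 * (a 0 : ℤ) - ν 0 * (a 1 : ℤ))) *
        (w 0 * (b 0 : ℤ) + w 1 * (b 1 : ℤ)) =
      ((ν 1 * (b 0 : ℤ) - ν 0 * (b 1 : ℤ)) - (ν 1 * (m 0 : ℤ) - ν 0 * (m 1 : ℤ))) *
        (w 0 * (m 0 : ℤ) + w 1 * (m 1 : ℤ)) +
      ((ν 1 * (m 0 : ℤ) - ν 0 * (m 1 : ℤ)) - (ν 1 * (a 0 : ℤ) - ν 0 * (a 1 : ℤ))) *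
        (w 0 * (m 0 : ℤ) + w 1 * (m 1 : ℤ)) := by
    linear_combination (-(w 0 * ((b 1 : ℤ) - (m 1 : ℤ)) - w 1 * ((b 0 : ℤ) - (m 0 : ℤ)))) * hla +
      (w 1 * ((m 0 : ℤ) - (a 0 : ℤ)) - w 0 * ((m 1 : ℤ) - (a 1 : ℤ))) * hlb
  nlinarith [i1, i2, key]

/-- Injectivity of the rotated parameter on a level line: two exponents with the same nonzero
`ν`-level `l` and the same value of `ν 1 * q 0 - ν 0 * q 1` are equal (`ν ≠ 0` as `l ≠ 0`, and
`q ↦ (ν · q, ν^⊥ · q)` has determinant `-(ν 0 ^ 2 + ν 1 ^ 2)`). [folklore] -/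
theorem eq_of_level_eq_of_rot_eq (ν : Fin 2 → ℤ) (l : ℤ) (hl0 : l ≠ 0) (a b : Fin 2 →₀ ℕ)
    (hla : ν 0 * (a 0 : ℤ) + ν 1 * (a 1 : ℤ) = l) (hlb : ν 0 * (b 0 : ℤ) + ν 1 * (b 1 : ℤ) = l)
    (hr : ν 1 * (a 0 : ℤ) - ν 0 * (a 1 : ℤ) = ν 1 * (b 0 : ℤ) - ν 0 * (b 1 : ℤ)) : a = b := by
  have hl : ν 0 * (a 0 : ℤ) + ν 1 * (a 1 : ℤ) = ν 0 * (b 0 : ℤ) + ν 1 * (b 1 : ℤ) :=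
    hla.trans hlb.symm
  have k0 : (ν 0 ^ 2 + ν 1 ^ 2) * ((a 0 : ℤ) - (b 0 : ℤ)) = 0 := by
    linear_combination ν 0 * hl + ν 1 * hr
  have k1 : (ν 0 ^ 2 + ν 1 ^ 2) * ((a 1 : ℤ) - (b 1 : ℤ)) = 0 := by
    linear_combination ν 1 * hl - ν 0 * hr
  have hν : ν 0 ^ 2 + ν 1 ^ 2 ≠ 0 := by
    intro h
    have h0 : ν 0 ^ 2 = 0 := by nlinarith [sq_nonneg (ν 0), sq_nonneg (ν 1)]
    have h1 : ν 1 ^ 2 = 0 := by nlinarith [sq_nonneg (ν 0), sq_nonneg (ν 1)]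
    rw [pow_eq_zero_iff two_ne_zero] at h0 h1
    rw [h0, h1] at hla
    exact hl0 (by simpa using hla.symm)
  have e0 : (a 0 : ℤ) = (b 0 : ℤ) := sub_eq_zero.mp ((mul_eq_zero.mp k0).resolve_left hν)
  have e1 : (a 1 : ℤ) = (b 1 : ℤ) := sub_eq_zero.mp ((mul_eq_zero.mp k1).resolve_left hν)
  ext i
  fin_cases i
  · exact_mod_cast e0
  · exact_mod_cast e1

/-- At most two south-west vertices per level: three pairwise distinct strict minimisers (for
positive integer weights) over a finite set `S` cannot lie on one level `ν · q = l` with `l ≠ 0`.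
[folklore] -/
theorem no_three_sw_on_level (S : Finset (Fin 2 →₀ ℕ)) (ν : Fin 2 → ℤ) (l : ℤ) (hl0 : l ≠ 0)
    (e₁ e₂ e₃ : Fin 2 →₀ ℕ) (h₁₂ : e₁ ≠ e₂) (h₁₃ : e₁ ≠ e₃) (h₂₃ : e₂ ≠ e₃)
    (hl₁ : ν 0 * (e₁ 0 : ℤ) + ν 1 * (e₁ 1 : ℤ) = l)
    (hl₂ : ν 0 * (e₂ 0 : ℤ) + ν 1 * (e₂ 1 : ℤ) = l)
    (hl₃ : ν 0 * (e₃ 0 : ℤ) + ν 1 * (e₃ 1 : ℤ) = l)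
    (hsw₁ : ∃ w : Fin 2 → ℤ, 0 < w 0 ∧ 0 < w 1 ∧ (e₁ ∈ S ∧ ∀ e' ∈ S, e' ≠ e₁ →
      w 0 * (e₁ 0 : ℤ) + w 1 * (e₁ 1 : ℤ) < w 0 * (e' 0 : ℤ) + w 1 * (e' 1 : ℤ)))
    (hsw₂ : ∃ w : Fin 2 → ℤ, 0 < w 0 ∧ 0 < w 1 ∧ (e₂ ∈ S ∧ ∀ e' ∈ S, e' ≠ e₂ →
      w 0 * (e₂ 0 : ℤ) + w 1 * (e₂ 1 : ℤ) < w 0 * (e' 0 : ℤ) + w 1 * (e' 1 : ℤ)))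
    (hsw₃ : ∃ w : Fin 2 → ℤ, 0 < w 0 ∧ 0 < w 1 ∧ (e₃ ∈ S ∧ ∀ e' ∈ S, e' ≠ e₃ →
      w 0 * (e₃ 0 : ℤ) + w 1 * (e₃ 1 : ℤ) < w 0 * (e' 0 : ℤ) + w 1 * (e' 1 : ℤ))) : False := by
  obtain ⟨w₁, -, -, hm₁, hmin₁⟩ := hsw₁
  obtain ⟨w₂, -, -, hm₂, hmin₂⟩ := hsw₂
  obtain ⟨w₃, -, -, hm₃, hmin₃⟩ := hsw₃
  have x₁₂ : ν 1 * (e₁ 0 : ℤ) - ν 0 * (e₁ 1 : ℤ) ≠ ν 1 * (e₂ 0 : ℤ) - ν 0 * (e₂ 1 : ℤ) :=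
    fun h => h₁₂ (eq_of_level_eq_of_rot_eq ν l hl0 e₁ e₂ hl₁ hl₂ h)
  have x₁₃ : ν 1 * (e₁ 0 : ℤ) - ν 0 * (e₁ 1 : ℤ) ≠ ν 1 * (e₃ 0 : ℤ) - ν 0 * (e₃ 1 : ℤ) :=
    fun h => h₁₃ (eq_of_level_eq_of_rot_eq ν l hl0 e₁ e₃ hl₁ hl₃ h)
  have x₂₃ : ν 1 * (e₂ 0 : ℤ) - ν 0 * (e₂ 1 : ℤ) ≠ ν 1 * (e₃ 0 : ℤ) - ν 0 * (e₃ 1 : ℤ) :=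
    fun h => h₂₃ (eq_of_level_eq_of_rot_eq ν l hl0 e₂ e₃ hl₂ hl₃ h)
  -- name the three parameter values so that the case split is linear arithmetic
  generalize hp₁ : ν 1 * (e₁ 0 : ℤ) - ν 0 * (e₁ 1 : ℤ) = p₁ at x₁₂ x₁₃
  generalize hp₂ : ν 1 * (e₂ 0 : ℤ) - ν 0 * (e₂ 1 : ℤ) = p₂ at x₁₂ x₂₃
  generalize hp₃ : ν 1 * (e₃ 0 : ℤ) - ν 0 * (e₃ 1 : ℤ) = p₃ at x₁₃ x₂₃
  have hcases : (p₁ < p₂ ∧ p₂ < p₃) ∨ (p₃ < p₂ ∧ p₂ < p₁) ∨ (p₂ < p₁ ∧ p₁ < p₃) ∨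
      (p₃ < p₁ ∧ p₁ < p₂) ∨ (p₁ < p₃ ∧ p₃ < p₂) ∨ (p₂ < p₃ ∧ p₃ < p₁) := by omega
  subst hp₁ hp₂ hp₃
  rcases hcases with h | h | h | h | h | h
  · exact not_strict_min_between ν w₂ e₁ e₂ e₃ (hl₁.trans hl₂.symm) (hl₃.trans hl₂.symm) h.1 h.2
      (hmin₂ e₁ hm₁ h₁₂) (hmin₂ e₃ hm₃ (Ne.symm h₂₃))
  · exact not_strict_min_between ν w₂ e₃ e₂ e₁ (hl₃.trans hl₂.symm) (hl₁.trans hl₂.symm) h.1 h.2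
      (hmin₂ e₃ hm₃ (Ne.symm h₂₃)) (hmin₂ e₁ hm₁ h₁₂)
  · exact not_strict_min_between ν w₁ e₂ e₁ e₃ (hl₂.trans hl₁.symm) (hl₃.trans hl₁.symm) h.1 h.2
      (hmin₁ e₂ hm₂ (Ne.symm h₁₂)) (hmin₁ e₃ hm₃ (Ne.symm h₁₃))
  · exact not_strict_min_between ν w₁ e₃ e₁ e₂ (hl₃.trans hl₁.symm) (hl₂.trans hl₁.symm) h.1 h.2
      (hmin₁ e₃ hm₃ (Ne.symm h₁₃)) (hmin₁ e₂ hm₂ (Ne.symm h₁₂))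
  · exact not_strict_min_between ν w₃ e₁ e₃ e₂ (hl₁.trans hl₃.symm) (hl₂.trans hl₃.symm) h.1 h.2
      (hmin₃ e₁ hm₁ h₁₃) (hmin₃ e₂ hm₂ h₂₃)
  · exact not_strict_min_between ν w₃ e₂ e₃ e₁ (hl₂.trans hl₃.symm) (hl₁.trans hl₃.symm) h.1 h.2
      (hmin₃ e₂ hm₂ h₂₃) (hmin₃ e₁ hm₁ h₁₃)

/-- Counting: if every point of `S` has `ν`-level in `{r * c | 1 ≤ r ≤ n}` with `c ≠ 0`, then `S`
has at most `2n` strict minimisers for positive integer weights (two per level). [folklore] -/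
theorem ncard_sw_le (n : ℕ) (S : Finset (Fin 2 →₀ ℕ)) (ν : Fin 2 → ℤ) (c : ℤ) (hc : c ≠ 0)
    (hlev : ∀ e ∈ S, ∃ r : ℕ, 1 ≤ r ∧ r ≤ n ∧ ν 0 * (e 0 : ℤ) + ν 1 * (e 1 : ℤ) = r * c) :
    {e : Fin 2 →₀ ℕ | ∃ w : Fin 2 → ℤ, 0 < w 0 ∧ 0 < w 1 ∧ (e ∈ S ∧ ∀ e' ∈ S, e' ≠ e →
      w 0 * (e 0 : ℤ) + w 1 * (e 1 : ℤ) < w 0 * (e' 0 : ℤ) + w 1 * (e' 1 : ℤ))}.ncard ≤ 2 * n := by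
  classical
  set SW := {e : Fin 2 →₀ ℕ | ∃ w : Fin 2 → ℤ, 0 < w 0 ∧ 0 < w 1 ∧ (e ∈ S ∧ ∀ e' ∈ S, e' ≠ e →
      w 0 * (e 0 : ℤ) + w 1 * (e 1 : ℤ) < w 0 * (e' 0 : ℤ) + w 1 * (e' 1 : ℤ))} with hSW
  have hsub : SW ⊆ ↑S := by
    rintro e ⟨w, -, -, he, -⟩
    exact he
  have hfin : SW.Finite := S.finite_toSet.subset hsub
  rw [Set.ncard_eq_toFinset_card SW hfin]
  set T := hfin.toFinset with hT
  have hmaps : ∀ e ∈ T, ν 0 * (e 0 : ℤ) + ν 1 * (e 1 : ℤ) ∈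
      (Finset.Icc 1 n).image (fun r : ℕ => (r : ℤ) * c) := by
    intro e he
    obtain ⟨r, hr1, hrn, hre⟩ := hlev e (hsub (hfin.mem_toFinset.mp he))
    exact Finset.mem_image.mpr ⟨r, Finset.mem_Icc.mpr ⟨hr1, hrn⟩, hre.symm⟩
  have hfib : ∀ l ∈ (Finset.Icc 1 n).image (fun r : ℕ => (r : ℤ) * c),
      (T.filter (fun e => ν 0 * (e 0 : ℤ) + ν 1 * (e 1 : ℤ) = l)).card ≤ 2 := by
    intro l hl
    have hl0 : l ≠ 0 := by
      obtain ⟨r, hr, rfl⟩ := Finset.mem_image.mp hl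
      have hr1 : 1 ≤ r := (Finset.mem_Icc.mp hr).1
      exact mul_ne_zero (by exact_mod_cast Nat.one_le_iff_ne_zero.mp hr1) hc
    refine not_lt.mp fun h3 => ?_
    obtain ⟨a, ha, b, hb, c', hc', hab, hac, hbc⟩ := Finset.two_lt_card.mp h3
    rw [Finset.mem_filter] at ha hb hc'
    exact no_three_sw_on_level S ν l hl0 a b c' hab hac hbc ha.2 hb.2 hc'.2
      (hfin.mem_toFinset.mp ha.1) (hfin.mem_toFinset.mp hb.1) (hfin.mem_toFinset.mp hc'.1)
  calc T.card ≤ 2 * ((Finset.Icc 1 n).image (fun r : ℕ => (r : ℤ) * c)).card :=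
        Finset.card_le_mul_card_image_of_maps_to hmaps 2 hfib
    _ ≤ 2 * (Finset.Icc 1 n).card := Nat.mul_le_mul_left 2 Finset.card_image_le
    _ = 2 * n := by simp

/-- Levels in a product: if every nonzero exponent of every factor `u i` has `ν`-level `c`, then
every nonzero exponent of `∏ i, u i` has `ν`-level `r * c` for some `1 ≤ r ≤ n` (`r` = the number
of nonzero letters in one decomposition of the exponent). [folklore] -/
theorem exists_level_of_mem_support_prod (ν : Fin 2 → ℤ) (c : ℤ) :
    ∀ (n : ℕ) (u : Fin n → MvPolynomial (Fin 2) ℂ),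
      (∀ i, ∀ q ∈ (u i).support, q ≠ 0 → ν 0 * (q 0 : ℤ) + ν 1 * (q 1 : ℤ) = c) →
      ∀ e ∈ (∏ i, u i).support, e ≠ 0 →
        ∃ r : ℕ, 1 ≤ r ∧ r ≤ n ∧ ν 0 * (e 0 : ℤ) + ν 1 * (e 1 : ℤ) = r * c := by
  classical
  intro n
  induction n with
  | zero =>
    intro u _ e he he0
    simp only [Finset.univ_eq_empty, Finset.prod_empty] at he
    refine absurd ?_ he0
    by_contra h
    rw [MvPolynomial.mem_support_iff, MvPolynomial.coeff_one, if_neg (Ne.symm h)] at he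
    exact he rfl
  | succ n ih =>
    intro u hu e he he0
    rw [Fin.prod_univ_succ] at he
    obtain ⟨a, ha, b, hb, rfl⟩ := Finset.mem_add.mp (MvPolynomial.support_mul _ _ he)
    by_cases ha0 : a = 0
    · subst ha0
      have hb0 : b ≠ 0 := by simpa using he0
      obtain ⟨r, hr1, hrn, hrb⟩ := ih (fun i => u i.succ) (fun i => hu i.succ) b hb hb0
      refine ⟨r, hr1, Nat.le_succ_of_le hrn, ?_⟩
      simpa using hrb
    · have hda := hu 0 a ha ha0
      by_cases hb0 : b = 0
      · subst hb0
        refine ⟨1, le_refl _, Nat.succ_le_succ (Nat.zero_le _), ?_⟩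
        simpa using hda
      · obtain ⟨r, -, hrn, hrb⟩ := ih (fun i => u i.succ) (fun i => hu i.succ) b hb hb0
        refine ⟨r + 1, Nat.succ_le_succ (Nat.zero_le _), Nat.succ_le_succ hrn, ?_⟩
        simp only [Finsupp.coe_add, Pi.add_apply, Nat.cast_add, Nat.cast_one]
        linear_combination hda + hrb

/-- STUB `stub_engineCollinear` (collinear rung of the engine): if all factors `u_i`, `v_i` have
constant term `1` and all their other monomials lie on one affine line `ν 0 * q 0 + ν 1 * q 1 = c`
(`ν ∈ ℤ²` arbitrary, `c ≠ 0`), then `∏ u_i - ∏ v_i` has at most `2n` south-west vertices (strict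
minimisers of a positive integer weight over its support): its support lies on the `n` parallel
lines `ν · q = r * c`, `1 ≤ r ≤ n`, each carrying at most two such vertices. [folklore] -/
theorem stub_engineCollinear : ∀ (n : ℕ) (u v : Fin n → MvPolynomial (Fin 2) ℂ) (ν : Fin 2 → ℤ) (c : ℤ),
    (∀ i, MvPolynomial.coeff 0 (u i) = 1) → (∀ i, MvPolynomial.coeff 0 (v i) = 1) → c ≠ 0 →
    (∀ i, ∀ q ∈ (u i).support, q ≠ 0 → ν 0 * (q 0 : ℤ) + ν 1 * (q 1 : ℤ) = c) →
    (∀ i, ∀ q ∈ (v i).support, q ≠ 0 → ν 0 * (q 0 : ℤ) + ν 1 * (q 1 : ℤ) = c) →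
    {e : Fin 2 →₀ ℕ | ∃ w : Fin 2 → ℤ, 0 < w 0 ∧ 0 < w 1 ∧ e ∈ (∏ i, u i - ∏ i, v i).support ∧
        ∀ e' ∈ (∏ i, u i - ∏ i, v i).support, e' ≠ e →
          w 0 * (e 0 : ℤ) + w 1 * (e 1 : ℤ) < w 0 * (e' 0 : ℤ) + w 1 * (e' 1 : ℤ)}.ncard ≤ 2 * n := by
  intro n u v ν c hu0 hv0 hc hu hv
  classical
  have hcu : MvPolynomial.coeff 0 (∏ i, u i) = 1 := by
    rw [← MvPolynomial.constantCoeff_eq, map_prod]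
    exact Finset.prod_eq_one fun i _ => hu0 i
  have hcv : MvPolynomial.coeff 0 (∏ i, v i) = 1 := by
    rw [← MvPolynomial.constantCoeff_eq, map_prod]
    exact Finset.prod_eq_one fun i _ => hv0 i
  have hconst : MvPolynomial.coeff 0 (∏ i, u i - ∏ i, v i) = 0 := by
    rw [MvPolynomial.coeff_sub, hcu, hcv, sub_self]
  refine ncard_sw_le n (∏ i, u i - ∏ i, v i).support ν c hc fun e he => ?_
  have he0 : e ≠ 0 := by
    rintro rfl
    exact (MvPolynomial.mem_support_iff.mp he) hconst
  rcases Finset.mem_union.mp (MvPolynomial.support_sub _ _ _ he) with h | h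
  · exact exists_level_of_mem_support_prod ν c n u hu e h he0
  · exact exists_level_of_mem_support_prod ν c n v hv e h he0

end Summit.ValiantsHypothesis.ValiantsHypothesis.Theorems.TwoProducts.Collinear
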